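import Summits.Ventures.PercRepro.RankLevelSetRuleQNineteenPitCertLoData

/-!
# PercRepro — THE TWO SIGN CERTIFICATES OF THE FAMILY `k = 19`, CERTIFIED BY KRONECKER POLYNOMIAL IDENTITY TESTING
(p4, gen 27; C-044; paper proofs/P4-CELL-THREE.md §13.4–13.5, §13.9)

`nineteen_lower_cert` / `nineteen_upper_cert`: `na·N + nb·D = P(q − m − 18, m)` for the two convergents `C_35` (lower) and `C_33` (upper),
where `P` is the certificate polynomial with 2475 resp. 2378 NON-NEGATIVE coefficients in `(a, b) = (q − m − 18, m)` — each identity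
is ONE evaluation at a Kronecker point (`PercRepro.PIT.pitE`) of the expression trees of RankLevelSetRuleQNineteenPitTrees against the
certificate data.  `nineteen_lower_nonneg` / `nineteen_upper_nonneg`: `na·C + nb ≥ 0` on the untruncated regime `m + 18 ≤ q` for both
convergents.  No `sorry`; axioms standard.
-/

namespace PercRepro

open PIT
/-- expression (left side) of the lower certificate identity. -/
def nineteenLowerE : PExpr := (.add (.mul nineteenNaE (.leaf cfThirtyFiveNData)) (.mul nineteenNbE (.leaf cfThirtyFiveDData)))

/-- expression (right side) of the lower certificate identity. -/
def nineteenLowerF : PExpr := (.comp nineteenP1Ab (.add (.add .va (.neg .vb)) (.const (-18))) .vb)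

set_option maxHeartbeats 4000000 in
set_option maxRecDepth 16384 in
/-- The lower certificate identity: `na·N + nb·D = P(q − m − 18, m)` (one Kronecker evaluation). -/
lemma nineteen_lower_cert (q m : ℚ) :
    naNineteen q m * cfThirtyFiveN q m + nbNineteen q m * cfThirtyFiveD q m = evalP (q - m - 18) m nineteenP1Ab := by
  have h := pitE 463 133 nineteenLowerE nineteenLowerF (by decide +kernel) (by decide +kernel) (by decide +kernel) (by decide +kernel) q m
  have h' : evalE q m nineteenNaE * evalP q m cfThirtyFiveNData + evalE q m nineteenNbE * evalP q m cfThirtyFiveDData = evalP (q + -m + ((-18 : ℤ) : ℚ)) m nineteenP1Ab := h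
  rw [naNineteen_evalE, nbNineteen_evalE, cfThirtyFiveN, cfThirtyFiveD, h']
  congr 1
  push_cast
  ring

/-- `na·C + nb ≥ 0` for the lower convergent on the untruncated regime `m + 18 ≤ q`. -/
lemma nineteen_lower_nonneg (q m : ℕ) (hm : m + 18 ≤ q) :
    0 ≤ naNineteen q m * (cfThirtyFiveN q m / cfThirtyFiveD q m) + nbNineteen q m := by
  have hD := cfThirtyFiveD_pos q m (by positivity) (by exact_mod_cast (show m + 1 ≤ q by omega))
  have ha : (0 : ℚ) ≤ (q : ℚ) - m - 18 := by
    have : ((m + 18 : ℕ) : ℚ) ≤ q := by exact_mod_cast hm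
    push_cast at this; linarith
  have key : 0 ≤ evalP ((q : ℚ) - m - 18) m nineteenP1Ab := evalP_nonneg _ (by decide +kernel) _ _ ha (by positivity)
  rw [← nineteen_lower_cert] at key
  have e : naNineteen q m * (cfThirtyFiveN q m / cfThirtyFiveD q m) + nbNineteen q m
      = (naNineteen q m * cfThirtyFiveN q m + nbNineteen q m * cfThirtyFiveD q m) / cfThirtyFiveD q m := by
    rw [← mul_div_assoc, div_add' _ _ _ hD.ne']
  rw [e]
  exact div_nonneg key hD.le

end PercRepro
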